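import Summits.BirchSwinnertonDyer.BirchSwinnertonDyer.Theorems.EisensteinPrimesBSDpOnCellCStubC3OneInequality
import Summits.BirchSwinnertonDyer.BirchSwinnertonDyer.Theorems.EisensteinPrimesBSDpOnCellCStubC3RoadHOther
import HarnessLib

/-!
# Crux 4 `BSDpOnCellC` (stmt-BirchSwinnertonDyer-19034), line b1 v10, stub `stub_c3`: the BDP-UNIT FRAME
# CERTIFICATE — at a datum where the frame's constant term `Q(0)` is a `p`-adic unit, road R-β +
# `μ(X_ac^∅) = 0` ALONE give the IMC atom c3♭′/c3s♭′ and `λ(X_ac^∅ strict at 𝔭̄) = 0` (cell `bsd-eis`,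
# seat `bsd-line-x2-p2` gen 2, D-0154 KEY row 5; route `EisensteinPrimes`; companions p611576
# `…StubC3OneInequality`, p613384 `…ResidualPub`)

HONEST FRAMING (cell `bsd-eis`, run/shared/lean/pub/bsd-eis/): conditional per-datum re-statements on
the binders of the typed halves of the IMC atom of line b1; everything PROVED from tree theorems; nothing
about any curve is asserted; nothing booked (RECORD ROAD ONLY, RULING L90/L92); X2 stays
CONSTRUCTION-SHAPED; no label or count moves; BSD and the anticyclotomic main conjecture are proved for
no curve. Helper attached to stmt-BirchSwinnertonDyer-19034 (`--supports`), closes no stub.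

## Why

p611576: the IMC atom ⟸ R-β + `μ = 0` both sides + `λ(𝓛) ≤ λ(X_ac^∅)`. The inequality is FREE in the
extreme case `λ(𝓛) = 0`, i.e. when the frame `Q` has its first unit coefficient at index `0` — when its
CONSTANT TERM `Q(0)`, the interpolated (BDP) value at the trivial character, is a `p`-adic unit. Then
(`le_of_C_pow_mul_mem` with `m = 0`) `λ(X_ac^∅) = 0`, `Ch_Λ(X_ac^∅)♭ = (1) = (Q)`, and the atom holds
with no `λ`-input and no analytic `μ`-input (a unit constant term IS `μ(𝓛) = λ(𝓛) = 0`). This is the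
anticyclotomic, c3′-level analogue of the cell's cyclotomic unit-certificate door (`L_p(E)` a unit ⇒
Mazur MC at the pair; p545218 / p548943): a PER-DATUM certificate shape, reading `‖Q(0)‖ = 1` off the
value half (`X2.Nonsplit/SplitBDPValueOnTreeInt`, Castella JIMJ 2.10–2.11 / LZZ at `p = 3`) when the
Heegner logarithm term is a unit.

* `nonsplit/splitIMCEqAt_of_divIntOther_of_unit_constantCoeff` — datum-level certificate, each sign.

What this is NOT: not class-wide (most B11 data have `λ(𝓛) > 0`); not a proof of R-β or of `μ(X_ac^∅) = 0`.

References: [Washington1997] §7.1; [KellerYin2024] §3 (arXiv:2402.12781v2, PRE — locator only);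
[Castella2018Exceptional] Thm. 2.10–2.11 (the value at `𝟙`, context); cell: RULING L90/L92, p545218, p611576.
-/

set_option autoImplicit false
set_option linter.dupNamespace false -- the summit namespace `…BirchSwinnertonDyer.BirchSwinnertonDyer.Theorems` (Sub = Summit, D-0017) trips it

noncomputable section

open scoped Classical MatrixGroups ModularForm

open CongruenceSubgroup WeierstrassCurve NumberField IsDedekindDomain Field PowerSeries
  Literature.NumberTheory.EllipticCurves Literature.NumberTheory.EllipticCurves.GreenbergSelmer
  Literature.NumberTheory.EllipticCurves.GreenbergVatsal2000
  Literature.NumberTheory.EllipticCurves.ModularForms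
  Literature.NumberTheory.EllipticCurves.Rank1Residual
  Literature.NumberTheory.EllipticCurves.Rank1Residual.Typed
  Literature.NumberTheory.GaloisRepresentations Literature.NumberTheory.GaloisCohomology
  Literature.NumberTheory.Automorphic
  Summit.BirchSwinnertonDyer.Rank1Residual.X11b.AcSelmer
  Summit.BirchSwinnertonDyer.Rank1Residual.X11b.Halves
  Summit.BirchSwinnertonDyer.Rank1Residual.X11b
  Summit.BirchSwinnertonDyer.Rank1Residual Summit.BirchSwinnertonDyer.Rank1Residual.X1
  Summit.BirchSwinnertonDyer.Rank1Residual.X2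
  Summit.BirchSwinnertonDyer.BirchSwinnertonDyer.Theorems.StubC3MuLambdaInvariants
  Summit.BirchSwinnertonDyer.BirchSwinnertonDyer.Theorems.StubC3OneInequality

namespace Summit.BirchSwinnertonDyer.BirchSwinnertonDyer.Theorems.StubC3UnitFrame

variable {p : ℕ} [Fact p.Prime] {W : WeierstrassCurve ℚ} [W.IsElliptic] [W.IsGloballyMinimal]

/-- **BDP-unit frame certificate for c3♭′ at a datum.** Given GZK, modularity, Poitou–Tate ×2
(torsion) and road R-β `X2.NonsplitKolyvaginDivOnTreeIntOther W p`: at every datum where `μ(X_ac^∅ strict at 𝔭̄) = 0`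
and the frame's CONSTANT TERM `Q(0)` (the interpolated value at the trivial character) is a `p`-adic UNIT,
the IMC atom `R1.IMCEqIntAt W p κ 𝔭̄ γ Q` holds and `λ(X_ac^∅) = 0` (so `Ch_Λ(X_ac^∅)♭ = (1) = (Q)`).
The anticyclotomic analogue, for c3′, of the cell's unit-certificate door; per-datum, CONDITIONAL, RECORD
ROAD ONLY (RULING L90/L92: books nothing). [claim: KellerYin2024, status: under-review]
[cite: KellerYin2024, §3 (arXiv:2402.12781v2) (shape only; nothing asserted)] [cite: Washington1997, §7.1 Prop. 7.2] -/
theorem nonsplitIMCEqAt_of_divIntOther_of_unit_constantCoeff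
    (hGZK : rank_eq_analyticRank_of_analyticRank_le_one) (hnf : exists_isNewformOf)
    (hPT : ∀ (K : Type) [Field K] [NumberField K], poitouTate_selmerStructure_duality K)
    (hPT2 : ∀ (K : Type) [Field K] [NumberField K], poitouTate_sha_tateDual K)
    (hdiv : NonsplitKolyvaginDivOnTreeIntOther W p) :
    ∀ (N : ℕ) [NeZero N] (K : Type) [Field K] [NumberField K] (Dt : ModularParametrizationData W N)
      (H : HeegnerDatum N (NumberField.discr K)) (ιK : K →+* ℂ) (P : (W.baseChange K).toAffine.Point),
      CellC W p → ¬ W.HasSplitMultiplicativeReductionAtPrime p → W.conductorNorm ℤ = N →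
      IsImaginaryQuadratic K → NumberField.discr K < -4 → SatisfiesHeegnerHypothesis N K →
      (W.quadraticTwist (NumberField.discr K : ℚ)).entireLFunction 1 ≠ 0 →
      WeierstrassCurve.Affine.Point.map ιK.toRatAlgHom P = heegnerPointComplex Dt H →
      ¬ (p : ℤ) ∣ Dt.c → ¬ IsOfFinAddOrder P →
      Odd (NumberField.discr K) →
      ∀ (κ : ZpExtension K p), κ.IsAnticyclotomic →
        ∀ (γ : Field.absoluteGaloisGroup K) [Fact (κ.IsTopGenerator γ)]
          (𝔭 : HeightOneSpectrum (𝓞 K)), ((p : ℕ) : 𝓞 K) ∈ 𝔭.asIdeal →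
          𝔭.asIdeal.ramificationIdx (𝓞 ℚ) = 1 → 𝔭.asIdeal.inertiaDeg (𝓞 ℚ) = 1 →
          ∀ (𝔭bar : HeightOneSpectrum (𝓞 K)), ((p : ℕ) : 𝓞 K) ∈ 𝔭bar.asIdeal → 𝔭bar ≠ 𝔭 →
            ((Ideal.span {(p : ℤ)}).primesOver (𝓞 K)).ncard = 2 →
          ∀ (f : CuspForm (CongruenceSubgroup.Gamma0 N) 2), IsNewformOf W f →
            ∀ (ι' : PadicAlgCl p ≃+* ℂ),
              (∀ (w : InfinitePlace K) (k : 𝓞 K),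
                k ∈ 𝔭.asIdeal ↔ ‖ι'.symm (w.embedding (k : K))‖ < 1) →
              ∀ (ΩK : ℂ) (Ωp : ℂ_[p]) (Q : PowerSeries 𝓞_ℂ_[p]), ΩK ≠ 0 → ‖Ωp‖ = 1 →
                R1.IsBDPLFunctionInt p ι' 𝔭 κ γ f ΩK Ωp Q →
                  muInvariant p (XAc (W.baseChange K) p κ 𝔭bar ∅ γ) = 0 →
                  ‖((PowerSeries.constantCoeff Q : 𝓞_ℂ_[p]) : ℂ_[p])‖ = 1 →
                    R1.IMCEqIntAt W p κ 𝔭bar γ Q ∧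
                      lambdaInvariant p (XAc (W.baseChange K) p κ 𝔭bar ∅ γ) = 0 := by
  intro N _ K _ _ Dt H ιK P hc hsg hN hK hd4 hHN hLt hP hcM hPinf hodd κ hκ γ _ 𝔭 h𝔭 he hf 𝔭bar h𝔭bar
    hne hsplit f hfW ι' hι' ΩK Ωp Q hΩK hΩp hQ hμ hunit
  obtain ⟨F, hF⟩ :=
    (charIdeal_isPrincipal_holds p (XAc (W.baseChange K) p κ 𝔭bar ∅ γ)).principal
  have hchar : XAc.charIdeal (W.baseChange K) p κ 𝔭bar ∅ γ = Ideal.span {F} := hF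
  obtain ⟨k, hk⟩ := hdiv N K Dt H ιK P hc hsg hN hK hd4 hHN hLt hP hcM hPinf hodd κ hκ γ 𝔭 h𝔭 he
    hf 𝔭bar h𝔭bar hne hsplit f hfW ι' hι' ΩK Ωp Q hΩK hΩp hQ
  haveI := module_finite_XAc_baseChange (W := W) p κ 𝔭bar γ
  have htor := isTorsion_xAc_other_of_cellC hGZK hnf hPT hPT2 hc hK
    (fun q hq hqp ↦ hHN q hq (hqp.trans (hN ▸
      Summit.BirchSwinnertonDyer.Rank1Residual.X11b.dvd_conductorNorm_of_mult (W := W) hc.2.2.2)))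
    hLt P hPinf κ hκ γ 𝔭bar h𝔭bar
  have hFn := firstUnitCoeff_map_toCpInt_of_charIdeal_eq_span _ htor hμ hchar
  have hQ0 : ‖((coeff 0 Q : 𝓞_ℂ_[p]) : ℂ_[p])‖ = 1 ∧ ∀ i < 0, ‖((coeff i Q : 𝓞_ℂ_[p]) : ℂ_[p])‖ < 1 :=
    ⟨by rwa [coeff_zero_eq_constantCoeff], fun i hi ↦ (Nat.not_lt_zero i hi).elim⟩
  rw [hchar, Ideal.map_span, Set.image_singleton] at hk
  have hle := le_of_C_pow_mul_mem hk hFn hQ0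
  refine ⟨?_, Nat.le_zero.mp hle⟩
  unfold R1.IMCEqIntAt
  rw [hchar, Ideal.map_span, Set.image_singleton]
  exact span_singleton_eq_of_C_pow_mul_mem_of_le hk hFn hQ0 (Nat.zero_le _)

/-- **BDP-unit frame certificate for c3s♭′ at a datum.** Given GZK, modularity, Poitou–Tate ×2
(torsion) and road R-β `X2.SplitKolyvaginDivOnTreeIntOther W p`: at every datum where `μ(X_ac^∅ strict at 𝔭̄) = 0`
and the frame's CONSTANT TERM `Q(0)` (the interpolated value at the trivial character) is a `p`-adic UNIT,
the IMC atom `R1.IMCEqIntAt W p κ 𝔭̄ γ Q` holds and `λ(X_ac^∅) = 0` (so `Ch_Λ(X_ac^∅)♭ = (1) = (Q)`).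
The anticyclotomic analogue, for c3′, of the cell's unit-certificate door; per-datum, CONDITIONAL, RECORD
ROAD ONLY (RULING L90/L92: books nothing). [claim: KellerYin2024, status: under-review]
[cite: KellerYin2024, §3 (arXiv:2402.12781v2) (shape only; nothing asserted)] [cite: Washington1997, §7.1 Prop. 7.2] -/
theorem splitIMCEqAt_of_divIntOther_of_unit_constantCoeff
    (hGZK : rank_eq_analyticRank_of_analyticRank_le_one) (hnf : exists_isNewformOf)
    (hPT : ∀ (K : Type) [Field K] [NumberField K], poitouTate_selmerStructure_duality K)
    (hPT2 : ∀ (K : Type) [Field K] [NumberField K], poitouTate_sha_tateDual K)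
    (hdiv : SplitKolyvaginDivOnTreeIntOther W p) :
    ∀ (N : ℕ) [NeZero N] (K : Type) [Field K] [NumberField K] (Dt : ModularParametrizationData W N)
      (H : HeegnerDatum N (NumberField.discr K)) (ιK : K →+* ℂ) (P : (W.baseChange K).toAffine.Point),
      CellC W p → W.HasSplitMultiplicativeReductionAtPrime p → W.conductorNorm ℤ = N →
      IsImaginaryQuadratic K → NumberField.discr K < -4 → SatisfiesHeegnerHypothesis N K →
      (W.quadraticTwist (NumberField.discr K : ℚ)).entireLFunction 1 ≠ 0 →
      WeierstrassCurve.Affine.Point.map ιK.toRatAlgHom P = heegnerPointComplex Dt H →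
      ¬ (p : ℤ) ∣ Dt.c → ¬ IsOfFinAddOrder P →
      Odd (NumberField.discr K) →
      ∀ (κ : ZpExtension K p), κ.IsAnticyclotomic →
        ∀ (γ : Field.absoluteGaloisGroup K) [Fact (κ.IsTopGenerator γ)]
          (𝔭 : HeightOneSpectrum (𝓞 K)), ((p : ℕ) : 𝓞 K) ∈ 𝔭.asIdeal →
          𝔭.asIdeal.ramificationIdx (𝓞 ℚ) = 1 → 𝔭.asIdeal.inertiaDeg (𝓞 ℚ) = 1 →
          ∀ (𝔭bar : HeightOneSpectrum (𝓞 K)), ((p : ℕ) : 𝓞 K) ∈ 𝔭bar.asIdeal → 𝔭bar ≠ 𝔭 →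
            ((Ideal.span {(p : ℤ)}).primesOver (𝓞 K)).ncard = 2 →
          ∀ (f : CuspForm (CongruenceSubgroup.Gamma0 N) 2), IsNewformOf W f →
            ∀ (ι' : PadicAlgCl p ≃+* ℂ),
              (∀ (w : InfinitePlace K) (k : 𝓞 K),
                k ∈ 𝔭.asIdeal ↔ ‖ι'.symm (w.embedding (k : K))‖ < 1) →
              ∀ (ΩK : ℂ) (Ωp : ℂ_[p]) (Q : PowerSeries 𝓞_ℂ_[p]), ΩK ≠ 0 → ‖Ωp‖ = 1 →
                R1.IsBDPLFunctionInt p ι' 𝔭 κ γ f ΩK Ωp Q →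
                  muInvariant p (XAc (W.baseChange K) p κ 𝔭bar ∅ γ) = 0 →
                  ‖((PowerSeries.constantCoeff Q : 𝓞_ℂ_[p]) : ℂ_[p])‖ = 1 →
                    R1.IMCEqIntAt W p κ 𝔭bar γ Q ∧
                      lambdaInvariant p (XAc (W.baseChange K) p κ 𝔭bar ∅ γ) = 0 := by
  intro N _ K _ _ Dt H ιK P hc hsg hN hK hd4 hHN hLt hP hcM hPinf hodd κ hκ γ _ 𝔭 h𝔭 he hf 𝔭bar h𝔭bar
    hne hsplit f hfW ι' hι' ΩK Ωp Q hΩK hΩp hQ hμ hunit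
  obtain ⟨F, hF⟩ :=
    (charIdeal_isPrincipal_holds p (XAc (W.baseChange K) p κ 𝔭bar ∅ γ)).principal
  have hchar : XAc.charIdeal (W.baseChange K) p κ 𝔭bar ∅ γ = Ideal.span {F} := hF
  obtain ⟨k, hk⟩ := hdiv N K Dt H ιK P hc hsg hN hK hd4 hHN hLt hP hcM hPinf hodd κ hκ γ 𝔭 h𝔭 he
    hf 𝔭bar h𝔭bar hne hsplit f hfW ι' hι' ΩK Ωp Q hΩK hΩp hQ
  haveI := module_finite_XAc_baseChange (W := W) p κ 𝔭bar γ
  have htor := isTorsion_xAc_other_of_cellC hGZK hnf hPT hPT2 hc hK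
    (fun q hq hqp ↦ hHN q hq (hqp.trans (hN ▸
      Summit.BirchSwinnertonDyer.Rank1Residual.X11b.dvd_conductorNorm_of_mult (W := W) hc.2.2.2)))
    hLt P hPinf κ hκ γ 𝔭bar h𝔭bar
  have hFn := firstUnitCoeff_map_toCpInt_of_charIdeal_eq_span _ htor hμ hchar
  have hQ0 : ‖((coeff 0 Q : 𝓞_ℂ_[p]) : ℂ_[p])‖ = 1 ∧ ∀ i < 0, ‖((coeff i Q : 𝓞_ℂ_[p]) : ℂ_[p])‖ < 1 :=
    ⟨by rwa [coeff_zero_eq_constantCoeff], fun i hi ↦ (Nat.not_lt_zero i hi).elim⟩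
  rw [hchar, Ideal.map_span, Set.image_singleton] at hk
  have hle := le_of_C_pow_mul_mem hk hFn hQ0
  refine ⟨?_, Nat.le_zero.mp hle⟩
  unfold R1.IMCEqIntAt
  rw [hchar, Ideal.map_span, Set.image_singleton]
  exact span_singleton_eq_of_C_pow_mul_mem_of_le hk hFn hQ0 (Nat.zero_le _)

end Summit.BirchSwinnertonDyer.BirchSwinnertonDyer.Theorems.StubC3UnitFrame

end
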